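import Literature.NumberTheory.NumberFields.PrincipalDivisorTransportGalois
import Literature.NumberTheory.NumberFields.InfinitelyDivisibleEqOne
import Mathlib.FieldTheory.Galois.Infinite
import Mathlib.FieldTheory.IsAlgClosed.Basic
import Mathlib.RingTheory.RootsOfUnity.Basic
import HarnessLib

/-!
# Frobenioids I, Example 6.3: a Galois-equivariant endomorphism of `F̄^×` that relabels the finite places of the
# number field `F` on principal divisors is the IDENTITY (classical rigidity of the rational-function monoid `B`)

Mochizuki, *The geometry of Frobenioids I: the general theory*, Kyushu J. Math. **62** (2008) 293–400, §6,
Example 6.3 pp. 112–114: the rational-function monoid `B : Spec L ↦ L^×` on `D = B(Gal(F̃/F))⁰` and the natural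
homomorphism `B(L) = L^× → Φ(L)^gp`, `f ↦ div(f)` [cite: MochizukiFrdI2008, Ex. 6.3 p.113]; Theorem 5.2 (ii) p. 101
(`B` is the rational-function monoid `O^×((−)^birat)` of the model Frobenioid, so every natural, `Div_B`-compatible
automorphism of `B` twists the model Frobenioid over the identity of the base — the tree's
`ModelFrobenioid.exists_unitAutTwist_selfEquivalence`).  Consumer locus (cell abc-iut, layer L5): [IUTchI] Example 5.1
(v) / Corollary 5.3 (i), kurims (May 2020) p. 128 and p. 144 l. 31–33 — the binder `hB` («a self-equivalence of
`ℱ^⊛(†𝒟^⊚)` over the identity of `†𝒟^⊛` induces the identity on the rational-function monoid», GAP-LEDGER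
G-L5t11g16-2 / D-G-L5t11g16-2, row «BRIGID-KUMMER» of the recorded split) reduces, at the arithmetic model where
`B(A) = (F̄^{Stab(a_A)})^×`, to the rigidity theorem of this file.  Nothing of [IUTchI] is asserted here.

CLASSICAL LEMMA (OURS): no [IUTchI] / [FrdI] statement is asserted — this is the number-theoretic half of the
[IUTchI] Ex 5.1 (v) binder `hB`, in the vocabulary of OUR model.  PROOF-ONLY file (cell abc-iut, seat abc-iut-L5-t16
gen 13, row «BRIGID-KUMMER», abc-iut-L5-lead RULINGS #160 (1), dir word abc-iut-L1-lead R245; no definition, no named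
fact, no instance, no notation).  Mathlib entry points: `rootsOfUnity.isCyclic` + `MonoidHom.map_cyclic`,
`IsAlgClosed.exists_pow_nat_eq`, `InfiniteGalois.fixedField_fixingSubgroup`, `ClassGroup` finiteness (through the
tree's `Literature.NumberTheory.NumberFields.exists_span_singleton_eq_pow`), `IsDedekindDomain.HeightOneSpectrum`
valuations (through the tree's `ordFin`, `ordFin_mk_mk0_eq_multiplicity`), and the tree's
`Literature.NumberTheory.NumberFields.eq_one_of_forall_exists_pow_eq` («an element of a number field with `n`-th roots
for all `n` is `1`»: `HeightOneSpectrum.mem_integers_of_valuation_le_one` + Northcott).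

**Theorem** (`eq_id_of_galEquivariant_of_ordFin_perm`).  Let `F` be a number field, `K/F` a Galois
extension with `K` algebraically closed (e.g. `K = F̄`), `ᾱ : K^× →* K^×` an ENDOMORPHISM commuting with every
`σ ∈ Gal(K/F)`, and `θ` a permutation of the finite places of `F` such that for every `u ∈ F^×` the element `ᾱ(u)`
(which lies in `F`) satisfies `ord_{θ w}(ᾱ u) = ord_w(u)` for all finite places `w`.  Then `ᾱ = id` (and `θ = id`,
`perm_eq_refl_of_galEquivariant_of_ordFin_perm`).

Proof.  (1) `rootsOfUnity N K` is cyclic, so `ᾱ ζ = ζ ^ m` on it for some `m = m_N ∈ ℤ`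
(`unitsEnd_exists_zpow_eq_of_pow_eq_one`).  (2) KUMMER DESCENT without cohomology
(`exists_mem_and_map_eq_zpow_mul_pow_of_galEquivariant`): for `u ∈ L^×`, `L ⊆ K` an intermediate field, and `w ∈ K` with
`w ^ N = u`, the element `c := ᾱ(w) / w ^ m` is fixed by `Gal(K/L)` (for `σ ∈ Gal(K/L)`, `σ w / w` is an `N`-th root of
unity, on which `ᾱ` is `(·)^m`), hence lies in `L` (`InfiniteGalois.fixedField_fixingSubgroup`), and
`ᾱ(u) = u ^ m · c ^ N`; likewise `ᾱ(L^×) ⊆ L^×`.  (3) ONE prime (`map_eq_self_of_pow_eq_one_of_galEquivariant_of_ordFin_perm`): for a maximal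
ideal `𝔭` of `𝓞 F` some power `𝔭 ^ h = (π)` is principal (`h ≥ 1`, finiteness of the class group); with `N := M · h`
and `ᾱ(π) = π ^ m · c ^ N` (`c ∈ F^×`), reading `ord` at the place `θ(w_𝔭)` gives `h = m · ord_{θ w_𝔭}(π) + M · h · k`
with `ord_{θ w_𝔭}(π) ∈ {0, h}`, whence `M ∣ m - 1` in either case, i.e. `ᾱ ζ = ζ` for every `M`-th root of unity
`ζ` (print's «`ℚ_{>0} ∩ Ẑ^× = {1}`» for this situation).  (4) Hence for every `u ∈ K^×` and every `n ≥ 1`,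
`ᾱ(u) / u` is an `n`-th power in the number field `F(u)`, so `ᾱ(u) / u = 1` by the tree's
`Literature.NumberTheory.NumberFields.eq_one_of_forall_exists_pow_eq` (an infinitely divisible element of a number
field is `1`).  No Kronecker/product-formula input is needed: the archimedean components never enter.
Nothing here bears on, or takes a side on, [IUTchIII] Cor. 3.12; nothing here asserts anything about abc.
-/

noncomputable section

namespace Literature.AlgebraicGeometry.Frobenioids

open NumberField IsDedekindDomain Literature.NumberTheory.NumberFields

/-! ### (1) An endomorphism of `K^×` is a power map on each `μ_N` -/

section RootsOfUnity

variable {K : Type} [Field K]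

/-- On the (cyclic) group of `N`-th roots of unity of a field, an endomorphism of `K^×` is `ζ ↦ ζ ^ m`
for some `m ∈ ℤ`. [folklore] -/
private theorem unitsEnd_exists_zpow_eq_of_pow_eq_one (ᾱ : Kˣ →* Kˣ) (N : ℕ) [NeZero N] :
    ∃ m : ℤ, ∀ ζ : Kˣ, ζ ^ N = 1 → ᾱ ζ = ζ ^ m := by
  have hmem : ∀ ζ : rootsOfUnity N K, ᾱ.restrict (rootsOfUnity N K) ζ ∈ rootsOfUnity N K := by
    intro ζ
    rw [mem_rootsOfUnity, MonoidHom.restrict_apply, ← map_pow, (mem_rootsOfUnity N (ζ : Kˣ)).mp ζ.2,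
      map_one]
  obtain ⟨m, hm⟩ := MonoidHom.map_cyclic ((ᾱ.restrict (rootsOfUnity N K)).codRestrict _ hmem)
  refine ⟨m, fun ζ hζ => ?_⟩
  have h := congrArg (fun x : rootsOfUnity N K => ((x : Kˣ))) (hm ⟨ζ, (mem_rootsOfUnity N ζ).mpr hζ⟩)
  simpa using h

end RootsOfUnity

/-! ### (2) Kummer descent for a Galois-equivariant endomorphism -/

section Kummer

variable {F : Type} [Field F] {K : Type} [Field K] [Algebra F K] (ᾱ : Kˣ →* Kˣ)
  (hσ : ∀ (σ : K ≃ₐ[F] K) (x : Kˣ), ᾱ (Units.map (σ : K →* K) x) = Units.map (σ : K →* K) (ᾱ x))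

include hσ

/-- A `Gal(K/F)`-equivariant endomorphism of `K^×` maps `L^×` into `L^×` for every intermediate field `L`
(`K/F` Galois: `L` is the fixed field of `Gal(K/L)`). [folklore] -/
private theorem coe_map_mem_of_galEquivariant [IsGalois F K] (L : IntermediateField F K) {u : Kˣ}
    (hu : (u : K) ∈ L) : ((ᾱ u : Kˣ) : K) ∈ L := by
  have key : ((ᾱ u : Kˣ) : K) ∈ IntermediateField.fixedField L.fixingSubgroup := by
    rw [IntermediateField.mem_fixedField_iff]
    intro σ hσL
    have hfix : Units.map (σ : K →* K) u = u :=
      Units.ext (by simpa using (IntermediateField.mem_fixingSubgroup_iff L σ).mp hσL _ hu)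
    have h := congrArg (fun x : Kˣ => (x : K)) (hσ σ u)
    simp only [hfix, Units.coe_map, MonoidHom.coe_coe] at h
    exact h.symm
  rwa [InfiniteGalois.fixedField_fixingSubgroup] at key

/-- **Kummer descent** for a `Gal(K/F)`-equivariant endomorphism `ᾱ` of `K^×` (`K` algebraically closed, `K/F`
Galois) which is `ζ ↦ ζ ^ m` on the `N`-th roots of unity: for `u ∈ L^×`, `L ⊆ K` an intermediate field,
`ᾱ(u) = u ^ m · c ^ N` for some `c ∈ L^×` — namely `c = ᾱ(w) / w ^ m` for any `N`-th root `w` of `u`, an element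
fixed by `Gal(K/L)`. [folklore] -/
private theorem exists_mem_and_map_eq_zpow_mul_pow_of_galEquivariant [IsGalois F K] [IsAlgClosed K]
    (L : IntermediateField F K) {u : Kˣ} (hu : (u : K) ∈ L) {N : ℕ} (hN : 0 < N) {m : ℤ}
    (hm : ∀ ζ : Kˣ, ζ ^ N = 1 → ᾱ ζ = ζ ^ m) :
    ∃ c : Kˣ, (c : K) ∈ L ∧ ᾱ u = u ^ m * c ^ N := by
  obtain ⟨w, hw⟩ := IsAlgClosed.exists_pow_nat_eq (u : K) hN
  have hw0 : w ≠ 0 := by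
    rintro rfl
    rw [zero_pow hN.ne'] at hw
    exact u.ne_zero hw.symm
  set W : Kˣ := Units.mk0 w hw0 with hW
  have hWN : W ^ N = u := Units.ext (by simp [hW, hw])
  refine ⟨ᾱ W * (W ^ m)⁻¹, ?_, ?_⟩
  · -- `c` is fixed by `Gal(K/L)`, hence lies in `L`
    have key : ((ᾱ W * (W ^ m)⁻¹ : Kˣ) : K) ∈ IntermediateField.fixedField L.fixingSubgroup := by
      rw [IntermediateField.mem_fixedField_iff]
      intro σ hσL
      -- `ζ := σ W / W` is an `N`-th root of unity since `u = W ^ N ∈ L` is fixed by `σ`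
      have hfixu : Units.map (σ : K →* K) u = u :=
        Units.ext (by simpa using (IntermediateField.mem_fixingSubgroup_iff L σ).mp hσL _ hu)
      obtain ⟨ζ, hζN, hσW⟩ : ∃ ζ : Kˣ, ζ ^ N = 1 ∧ Units.map (σ : K →* K) W = ζ * W :=
        ⟨Units.map (σ : K →* K) W * W⁻¹,
          by rw [mul_pow, inv_pow, ← map_pow, hWN, hfixu, mul_inv_cancel],
          by rw [inv_mul_cancel_right]⟩
      have hcalc : Units.map (σ : K →* K) (ᾱ W * (W ^ m)⁻¹) = ᾱ W * (W ^ m)⁻¹ := by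
        rw [map_mul, map_inv, map_zpow, ← hσ σ W, hσW, map_mul, hm ζ hζN, mul_zpow, mul_inv,
          mul_comm (ζ ^ m) (ᾱ W), mul_assoc, mul_inv_cancel_left]
      have h := congrArg (fun x : Kˣ => (x : K)) hcalc
      simpa only [Units.coe_map, MonoidHom.coe_coe] using h
    rwa [InfiniteGalois.fixedField_fixingSubgroup] at key
  · calc ᾱ u = ᾱ (W ^ N) := by rw [hWN]
      _ = (W ^ m * (ᾱ W * (W ^ m)⁻¹)) ^ N := by rw [map_pow, mul_comm, inv_mul_cancel_right]
      _ = (W ^ m) ^ N * (ᾱ W * (W ^ m)⁻¹) ^ N := mul_pow _ _ _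
      _ = u ^ m * (ᾱ W * (W ^ m)⁻¹) ^ N := by
        rw [← zpow_natCast (W ^ m), ← zpow_mul, mul_comm m, zpow_mul, zpow_natCast, hWN]

end Kummer

section Inj

variable {F : Type} [Field F] {K : Type} [Field K] [Algebra F K]

/-- `F ↪ K` is injective on units. [folklore] -/
private theorem unitsMap_algebraMap_injective : Function.Injective (Units.map (algebraMap F K : F →* K)) := by
  intro x y hxy
  have h := congrArg (fun z : Kˣ => (z : K)) hxy
  simp only [Units.coe_map, MonoidHom.coe_coe] at h
  exact Units.ext ((algebraMap F K).injective h)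

end Inj

/-! ### (3) One prime: `ᾱ` fixes every root of unity -/

section OnePrime

variable {F : Type} [Field F] [NumberField F]

/-- `ord_w` is a homomorphism: `ord_w(1) = 0`. [cite: MochizukiFrdI2008, Ex. 6.3 p.112] -/
theorem ordFin_one (w : FinitePlace F) : ordFin F w 1 = 0 := by
  have h := ordFin_mul w 1 1
  rw [mul_one] at h
  omega

/-- `ord_w(x ^ m) = m · ord_w(x)` for `m ∈ ℤ`. [cite: MochizukiFrdI2008, Ex. 6.3 p.112] -/
theorem ordFin_zpow (w : FinitePlace F) (x : Fˣ) (m : ℤ) : ordFin F w (x ^ m) = m * ordFin F w x := by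
  let φ : Fˣ →* Multiplicative ℤ :=
    { toFun := fun x => Multiplicative.ofAdd (ordFin F w x)
      map_one' := by rw [ordFin_one, ofAdd_zero]
      map_mul' := fun x y => by rw [ordFin_mul, ofAdd_add] }
  have h := map_zpow φ x m
  have h' := congrArg Multiplicative.toAdd h
  simpa [φ, mul_comm] using h'

/-- `ord_w(x ^ n) = n · ord_w(x)` for `n ∈ ℕ`. [cite: MochizukiFrdI2008, Ex. 6.3 p.112] -/
theorem ordFin_pow (w : FinitePlace F) (x : Fˣ) (n : ℕ) : ordFin F w (x ^ n) = n * ordFin F w x := by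
  have h := ordFin_zpow w x (n : ℤ)
  rwa [zpow_natCast] at h

/-- The order of a generator `π` of `𝔭 ^ h` at the place of `𝔭` is `h`. [cite: MochizukiFrdI2008, Ex. 6.3 p.113] -/
theorem ordFin_mk0_eq_of_maximalIdeal_eq (𝔭 : HeightOneSpectrum (𝓞 F)) {h : ℕ} {π : 𝓞 F} (hπ : π ≠ 0)
    (hπF : (π : F) ≠ 0) (hspan : Ideal.span {π} = 𝔭.asIdeal ^ h) {w : FinitePlace F}
    (hw : w.maximalIdeal = 𝔭) : ordFin F w (Units.mk0 (π : F) hπF) = h := by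
  rw [← FinitePlace.mk_maximalIdeal w, hw, ordFin_mk_mk0_eq_multiplicity 𝔭 hπ hπF, hspan,
    multiplicity_pow_self (by rw [Ne, Submodule.zero_eq_bot]; exact 𝔭.ne_bot) 𝔭.irreducible.not_isUnit]

/-- The order of a generator `π` of `𝔭 ^ h` at a finite place other than that of `𝔭` is `0`.
[cite: MochizukiFrdI2008, Ex. 6.3 p.113] -/
theorem ordFin_mk0_eq_zero_of_maximalIdeal_ne (𝔭 : HeightOneSpectrum (𝓞 F)) {h : ℕ} {π : 𝓞 F} (hπ : π ≠ 0)
    (hπF : (π : F) ≠ 0) (hspan : Ideal.span {π} = 𝔭.asIdeal ^ h) {w : FinitePlace F}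
    (hw : w.maximalIdeal ≠ 𝔭) : ordFin F w (Units.mk0 (π : F) hπF) = 0 := by
  rw [← FinitePlace.mk_maximalIdeal w, ordFin_mk_mk0_eq_multiplicity w.maximalIdeal hπ hπF, hspan,
    multiplicity_asIdeal_pow_of_ne hw, Nat.cast_zero]

variable {K : Type} [Field K] [Algebra F K] (ᾱ : Kˣ →* Kˣ)
  (hσ : ∀ (σ : K ≃ₐ[F] K) (x : Kˣ), ᾱ (Units.map (σ : K →* K) x) = Units.map (σ : K →* K) (ᾱ x))
  (θ : Equiv.Perm (FinitePlace F))
  (hval : ∀ u : Fˣ, ∃ u' : Fˣ, Units.map (algebraMap F K : F →* K) u' = ᾱ (Units.map (algebraMap F K : F →* K) u) ∧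
    ∀ w : FinitePlace F, ordFin F (θ w) u' = ordFin F w u)

include hσ hval

/-- **`ᾱ` fixes every root of unity** (the step «`ℚ_{>0} ∩ Ẑ^× = {1}`»): if the `Gal(K/F)`-equivariant endomorphism
`ᾱ` of `K^×` relabels the finite places of `F` on `F^×` through `θ`, then `ᾱ ζ = ζ` whenever `ζ ^ M = 1`, `M ≥ 1`.
One maximal ideal `𝔭` with `𝔭 ^ h = (π)` principal and Kummer descent at level `N = M · h` give
`h = m · ord_{θ w_𝔭}(π) + M · h · ord_{θ w_𝔭}(c)` with `ord_{θ w_𝔭}(π) ∈ {0, h}`, whence `M ∣ m - 1`.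
[cite: MochizukiFrdI2008, Ex. 6.3 p.113] -/
theorem map_eq_self_of_pow_eq_one_of_galEquivariant_of_ordFin_perm [IsGalois F K] [IsAlgClosed K] {M : ℕ}
    (hM : 0 < M) (ζ : Kˣ) (hζ : ζ ^ M = 1) : ᾱ ζ = ζ := by
  classical
  -- one maximal ideal of `𝓞 F` and a principal power of it
  obtain ⟨I, hI⟩ := Ideal.exists_maximal (𝓞 F)
  let 𝔭 : HeightOneSpectrum (𝓞 F) :=
    ⟨I, hI.isPrime, Ring.ne_bot_of_isMaximal_of_not_isField hI (RingOfIntegers.not_isField F)⟩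
  obtain ⟨h, π, hh, hπ, hspan⟩ := exists_span_singleton_eq_pow 𝔭
  have hπF : (π : F) ≠ 0 := fun h0 => hπ (by exact_mod_cast h0)
  set π₀ : Fˣ := Units.mk0 (π : F) hπF with hπ₀
  -- the exponent of `ᾱ` on `μ_N`, `N = M · h`
  set N : ℕ := M * h with hN
  have hNpos : 0 < N := Nat.mul_pos hM (Nat.pos_of_ne_zero hh)
  haveI : NeZero N := ⟨hNpos.ne'⟩
  obtain ⟨m, hm⟩ := unitsEnd_exists_zpow_eq_of_pow_eq_one ᾱ N
  -- Kummer descent over `⊥ = F`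
  have hu : ((Units.map (algebraMap F K : F →* K) π₀ : Kˣ) : K) ∈ (⊥ : IntermediateField F K) := by
    rw [IntermediateField.mem_bot]
    exact ⟨(π₀ : F), by simp⟩
  obtain ⟨c, hc, hαπ⟩ := exists_mem_and_map_eq_zpow_mul_pow_of_galEquivariant ᾱ hσ ⊥ hu hNpos hm
  rw [IntermediateField.mem_bot] at hc
  obtain ⟨c₁, hc₁⟩ := hc
  have hc₁0 : c₁ ≠ 0 := by
    rintro rfl
    rw [map_zero] at hc₁
    exact c.ne_zero hc₁.symm
  set c₀ : Fˣ := Units.mk0 c₁ hc₁0 with hc₀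
  have hcc₀ : Units.map (algebraMap F K : F →* K) c₀ = c := Units.ext (by simp [hc₀, hc₁])
  -- the partner `u'` of `π₀` IS `π₀ ^ m · c₀ ^ N`
  obtain ⟨u', hu', hord⟩ := hval π₀
  have hu'eq : u' = π₀ ^ m * c₀ ^ N := by
    apply unitsMap_algebraMap_injective (K := K)
    rw [hu', hαπ, map_mul, map_zpow, map_pow, hcc₀]
  -- read the orders at the place `θ w_𝔭`
  have hw𝔭 : (FinitePlace.mk 𝔭).maximalIdeal = 𝔭 := FinitePlace.maximalIdeal_mk 𝔭
  have hread := hord (FinitePlace.mk 𝔭)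
  rw [hu'eq, ordFin_mul, ordFin_zpow, ordFin_pow,
    ordFin_mk0_eq_of_maximalIdeal_eq 𝔭 hπ hπF hspan hw𝔭] at hread
  -- in either case `M ∣ m - 1`
  have hdvd : (M : ℤ) ∣ m - 1 := by
    have hh0 : (h : ℤ) ≠ 0 := by exact_mod_cast hh
    by_cases hfix : (θ (FinitePlace.mk 𝔭)).maximalIdeal = 𝔭
    · -- `h = m h + (M h) k`
      rw [ordFin_mk0_eq_of_maximalIdeal_eq 𝔭 hπ hπF hspan hfix] at hread
      refine ⟨-ordFin F (θ (FinitePlace.mk 𝔭)) c₀, ?_⟩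
      have : (h : ℤ) * (m - 1 + (M : ℤ) * ordFin F (θ (FinitePlace.mk 𝔭)) c₀) = 0 := by
        push_cast [hN] at hread
        linear_combination hread
      have h2 := (mul_eq_zero.mp this).resolve_left hh0
      linear_combination h2
    · -- `h = (M h) k` forces `M = 1`
      rw [ordFin_mk0_eq_zero_of_maximalIdeal_ne 𝔭 hπ hπF hspan hfix] at hread
      have : (h : ℤ) * (1 - (M : ℤ) * ordFin F (θ (FinitePlace.mk 𝔭)) c₀) = 0 := by
        push_cast [hN] at hread
        linear_combination -hread
      have h2 := (mul_eq_zero.mp this).resolve_left hh0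
      have hM1 : (M : ℤ) ∣ 1 := ⟨ordFin F (θ (FinitePlace.mk 𝔭)) c₀, by linear_combination h2⟩
      exact hM1.trans (one_dvd _)
  -- conclude: `ζ ^ N = 1`, `ᾱ ζ = ζ ^ m = ζ`
  have hζN : ζ ^ N = 1 := by rw [hN, pow_mul, hζ, one_pow]
  obtain ⟨k, hk⟩ := hdvd
  have hζM : ζ ^ (M : ℤ) = 1 := by rw [zpow_natCast, hζ]
  calc ᾱ ζ = ζ ^ m := hm ζ hζN
    _ = ζ ^ (m - 1) * ζ := by rw [sub_eq_add_neg, zpow_add, zpow_neg_one, inv_mul_cancel_right]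
    _ = ζ := by rw [hk, zpow_mul, hζM, one_zpow, one_mul]

/-! ### (4) The theorem -/

/-- **A Galois-equivariant endomorphism of `K^×` that relabels the finite places of `F` on principal divisors is the
identity.**  For a number field `F`, a Galois extension `K/F` with `K` algebraically closed, an endomorphism
`ᾱ : K^× →* K^×` commuting with `Gal(K/F)`, and a permutation `θ` of the finite places of `F` with
`ord_{θ w}(ᾱ u) = ord_w(u)` for all `u ∈ F^×` and all `w`: `ᾱ = id`.  By (3) `ᾱ` fixes `μ_n` pointwise for every
`n ≥ 1`, so by Kummer descent `ᾱ(u) / u` is an `n`-th power in the number field `F(u)` for every `n`, hence `= 1`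
(`eq_one_of_forall_exists_pow_eq`). [cite: MochizukiFrdI2008, Ex. 6.3 p.113] -/
theorem eq_id_of_galEquivariant_of_ordFin_perm [IsGalois F K] [IsAlgClosed K] :
    ᾱ = MonoidHom.id Kˣ := by
  ext u
  -- the number field `L = F(u)`
  have hint : _root_.IsIntegral F (u : K) := Algebra.IsIntegral.isIntegral _
  let L : IntermediateField F K := IntermediateField.adjoin F {(u : K)}
  haveI : FiniteDimensional F L := IntermediateField.adjoin.finiteDimensional hint
  haveI : NumberField L := NumberField.of_module_finite F L
  have huL : (u : K) ∈ L := IntermediateField.mem_adjoin_simple_self F (u : K)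
  -- `x := ᾱ u / u ∈ L`
  set x : Kˣ := ᾱ u * u⁻¹ with hx
  have hxL : (x : K) ∈ L := by
    rw [hx, Units.val_mul, Units.val_inv_eq_inv_val]
    exact mul_mem (coe_map_mem_of_galEquivariant ᾱ hσ L huL) (inv_mem huL)
  -- `x` is an `n`-th power in `L` for every `n ≥ 1`
  have hdiv : ∀ n : ℕ, 0 < n → ∃ b : L, b ^ n = (⟨(x : K), hxL⟩ : L) := by
    intro n hn
    have hm : ∀ ζ : Kˣ, ζ ^ n = 1 → ᾱ ζ = ζ ^ (1 : ℤ) := fun ζ hζ => by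
      rw [zpow_one]; exact map_eq_self_of_pow_eq_one_of_galEquivariant_of_ordFin_perm ᾱ hσ θ hval hn ζ hζ
    obtain ⟨c, hcL, hc⟩ := exists_mem_and_map_eq_zpow_mul_pow_of_galEquivariant ᾱ hσ L huL hn hm
    refine ⟨⟨(c : K), hcL⟩, Subtype.ext ?_⟩
    have hxc : x = c ^ n := by rw [hx, hc, zpow_one, mul_comm (u : Kˣ), mul_inv_cancel_right]
    simp [hxc]
  have hx0 : (⟨(x : K), hxL⟩ : L) ≠ 0 := by
    intro h0
    exact x.ne_zero (congrArg Subtype.val h0)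
  have hx1 := eq_one_of_forall_exists_pow_eq hx0 hdiv
  have hx1' : (x : K) = 1 := congrArg Subtype.val hx1
  have hx1'' : x = 1 := Units.ext hx1'
  rw [hx, mul_inv_eq_one] at hx1''
  simpa using congrArg (fun z : Kˣ => (z : K)) hx1''

/-- … and the permutation `θ` is the identity: `ord_{θ w}(u) = ord_w(u)` for all `u`, and distinct finite places are
separated by a principal power of a prime. [cite: MochizukiFrdI2008, Ex. 6.3 p.113] -/
theorem perm_eq_refl_of_galEquivariant_of_ordFin_perm [IsGalois F K] [IsAlgClosed K] :
    θ = Equiv.refl _ := by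
  classical
  have hid := eq_id_of_galEquivariant_of_ordFin_perm ᾱ hσ θ hval
  ext w
  -- a principal power of the prime of `w`
  obtain ⟨h, π, hh, hπ, hspan⟩ := exists_span_singleton_eq_pow w.maximalIdeal
  have hπF : (π : F) ≠ 0 := fun h0 => hπ (by exact_mod_cast h0)
  obtain ⟨u', hu', hord⟩ := hval (Units.mk0 (π : F) hπF)
  rw [hid, MonoidHom.id_apply] at hu'
  have hu'eq := unitsMap_algebraMap_injective hu'
  subst hu'eq
  have hread := hord w
  rw [ordFin_mk0_eq_of_maximalIdeal_eq w.maximalIdeal hπ hπF hspan rfl] at hread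
  by_contra hne
  have hne' : (θ w).maximalIdeal ≠ w.maximalIdeal := fun h' => hne ((FinitePlace.maximalIdeal_inj _ _).mp h')
  rw [ordFin_mk0_eq_zero_of_maximalIdeal_ne w.maximalIdeal hπ hπF hspan hne'] at hread
  exact hh (by exact_mod_cast hread.symm)

end OnePrime

end Literature.AlgebraicGeometry.Frobenioids

end
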